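import Literature.Computability.Cryptography.HallgrenClassGroupDiscriminant
import Literature.Computability.Cryptography.HallgrenClassGroupERH
import Literature.Computability.Cryptography.HallgrenClassGroupClassNumberBound
import HarnessLib

/-!
# Hallgren 2005 / class numbers under GRH — step N3d: `√d ≤ C · h(−d) · log d` under the Grand
# Riemann Hypothesis, for negative fundamental discriminants `−d`

Topic `Literature/Computability/Cryptography`; proof companion of `HallgrenClassGroup.lean`
(named fact `Hallgren2005_classNumber_qsolvable_of_GRH`). Everything here is PROVED (theorems
only; no definition, no named fact). This file only assembles three earlier steps at the level of
the data of the fact (`d : ℕ` with `IsNegFundamentalDiscr d`, the hypothesis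
`GrandRiemannHypothesisGL`, the combinatorial class number `BinaryQuadraticForm.classNumber (−d)`):

* N1 `IsNegFundamentalDiscr.exists_numberField`, `.classNumber_eq` (`HallgrenClassGroupDiscriminant`):
  an imaginary quadratic `K` with `d_K = −d` and `h(−d) = h_K`;
* N2 `extendedRiemannHypothesis_of_grandRiemannHypothesisGL` (`HallgrenClassGroupERH`): GRH for
  `GL` gives the Riemann hypothesis for `ζ_K`;
* N3c `sqrt_natAbs_discr_le_classNumber_mul_log_of_erh` (`HallgrenClassGroupClassNumberBound`):
  under it, `√|d_K| ≤ (24C + 100) h_K log|d_K|`.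

Result: `sqrt_le_classNumber_mul_log_of_grandRiemannHypothesisGL` —
**`√d ≤ (24 C + 100) · h(−d) · log d`** (`C = grhPsiConst`), the form consumed by the analysis of
the random-forms sampler (a class outside any proper subgroup of `Cl(−d)` is drawn with
probability `≫ 1/polylog(d)`).

## References

* J. E. Littlewood, Proc. LMS 27 (1928) (the sharp conditional bound `h(−d) ≫ √d/log log d`).
* A. M. Childs, W. van Dam, Rev. Mod. Phys. 82 (2010), §5.7 ("assuming the GRH") [ChildsVandam2010].
-/

noncomputable section

open Module NumberField
open Literature.NumberTheory.EllipticCurves Literature.NumberTheory.LFunctions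
open Literature.NumberTheory.QuadraticFields.BinaryQuadraticForm (classNumber)

namespace Literature.Computability.Cryptography.Hallgren2005

/-- **Under the Grand Riemann Hypothesis, `√d ≤ (24C + 100) · h(−d) · log d` for every negative
fundamental discriminant `−d`** (`C = grhPsiConst`; `h(−d)` the number of reduced forms of
discriminant `−d`). Assembly of N1 (a quadratic field of discriminant `−d`, `h(−d) = h_K`), N2
(GRH ⇒ ERH for `K`) and N3c (ERH ⇒ `√|d_K| ≤ (24C+100) h_K log|d_K|`). [cite: ChildsVandam2010, §5.7 (p. 24 of arXiv:0812.0380)] -/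
theorem sqrt_le_classNumber_mul_log_of_grandRiemannHypothesisGL {d : ℕ} (hd : IsNegFundamentalDiscr d)
    (hGL : GrandRiemannHypothesisGL) :
    Real.sqrt d ≤ (24 * grhPsiConst + 100) * classNumber (-(d : ℤ)) * Real.log d := by
  obtain ⟨K, _, _, h2, hdisc⟩ := hd.exists_numberField
  have hK : IsImaginaryQuadratic K :=
    isImaginaryQuadratic_iff_discr_neg.2 ⟨h2, by rw [hdisc]; exact hd.neg_lt_zero⟩
  have hERH := extendedRiemannHypothesis_of_grandRiemannHypothesisGL hGL h2
  have hmain := sqrt_natAbs_discr_le_classNumber_mul_log_of_erh hK hERH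
  have hnat : (NumberField.discr K).natAbs = d := by rw [hdisc]; simp
  rw [hnat, ← hd.classNumber_eq h2 hdisc] at hmain
  exact hmain

end Literature.Computability.Cryptography.Hallgren2005

end
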